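import Summits.CriticalPhenomena.PercolationContinuityZ3.Theorems.PercNearOneGluingNoHeavyConstsMDLXJointXEdge
import Summits.CriticalPhenomena.PercolationContinuityZ3.Theorems.PercNearOneGluingNoHeavyConstsMDLXJointImpliesMDLX
import HarnessLib

/-!
# MDL(X)′ follows from the CROSS members: induction on the pairs at the avoided set
# (PAPER-2 track (ii): constants of the CSH family; seat `prim-consts-2`, gen 18)

builds on p205010 (kernel theorem, internal audit signed; external expert review pending).  Support file (`--supports
stmt-CriticalPhenomena-4575`); memo `run/shared/lean/prim/consts/FROM-prim-consts-2-g18-XEDGE-CROSS.md`.  One `Prop` definition (an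
OPEN statement of this programme, tagged `@[conjecture]`), theorems; no sorries; standard axioms.

With the polarised margin `P(X₀,X₁,X₂) = Consts.polMargin μ s y z F X₀ X₁ X₂` of `…ConstsMDLXJointXEdge` (MDL(X)′ = `P(X,X,X) ≥ 0`) and
`X' = X ∪ {u}`, the two CROSS MEMBERS are
  `M₁ = P(X',X,X) + P(X,X',X) + P(X,X,X')`,   `M₂ = P(X',X',X) + P(X',X,X') + P(X,X',X')`
(the middle Bernstein coefficients of the MDL(X)′ margin of `G + (pair x–u of weight q)` as a cubic in `q`, `Consts.polMargin_xEdge_expand`).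

* `Consts.CrossRel` — **CONJECTURE CROSS (OPEN, this programme):** for every weighted graph on which MDL(X)′ holds (all placements, all
  monotone functionals), every placement `(s, y, z, X)` with `s, y ∉ X`, every vertex `u ∉ X ∪ {s, y}` and every monotone `F`: `M₁ ≥ 0` and
  `M₂ ≥ 0`.  EVIDENCE (exact rational arithmetic, engines `engines/cross*.py` of this seat, min over ALL up-sets by min-cut): 0 violations on
  ≈ 1 200 random instances `n ≤ 7`, `|X| ∈ {1,2}`; the members are NOT cellwise signed (the 8 cells `E[Φ·1{ρ = r}]` by which copies avoid
  `u` fail individually) but the partial sums `E[Φ; N ≥ k]` from the top are (0 violations), and two cells are atoms: `P(X',X',X')`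
  (= MDL(X∪u)′) and the cell "copy 0 has `s ↔ u`, exactly one of copies 1, 2 avoids `u`" (0 violations).  It is implied by
  `Consts.MDLXJointBernstein` (coefficientwise three-copy positivity), of which it is the single-pair shadow at a pair of the avoided set.
* `Consts.crossRel_marker` — **THEOREM: CROSS holds for `u = y`** (then `P(X', ·, ·)`-terms vanish, `M₂ = μ(T)·cov_{D∩{s↮y}}(F; s↔z) ≥ 0` by
  vdBHK Thm 1.3, and `μ(D)μ(D')·M₁ = μ(D')²·margin(F) + μ(T)μ(D)²·cov' + cov_D(F; s↔y)·margin(1{s↔y})`, the last factor being the marker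
  corner `ν(Z|Y) − ν(Z|N) ≥ p'`, i.e. MDL(X)′ at `F = 1{s↔y}`).
* `Consts.polMargin_nonneg_of_isolated` — the base case: if every pair at `X` has weight `0`, MDL(X)′ is the tree's MDL(X)
  (`CovTau.markerDominanceAvoid`; the conditioning `{s ↮ X}` is almost sure).
* `Consts.mdlxJoint_of_crossRel` — **THEOREM: `CrossRel → MDLXJoint`.**  Strong induction on the number of pairs of nonzero weight: expand along
  a pair `s(x,u)`, `x ∈ X`, of nonzero weight (`Consts.polMargin_nonneg_of_members`); the extreme members are MDL(X)′ margins of the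
  pair-deleted law (induction), the middle ones are CROSS members (pairs inside `X ∪ {s}` contribute nothing, `u = y` is `crossRel_marker`).
  So MDL(X)′ — an inequality about ALL weighted graphs — is reduced to the one-vertex enlargement `X → X ∪ {u}` of the avoided set on a
  graph where MDL(X)′ is already known.
[cite: VandenbergHaggstromKahn2005, Thm. 1.1 (pp. 3–5) (induction conditioning on the edges at the avoided set), Thm. 1.3 (p. 6), §2.1 (pp. 9–13)]
[cite: Grimmett1999, §2.4]
-/

noncomputable section

namespace Summit.CriticalPhenomena.PercolationContinuityZ3.Theorems

open MeasureTheory Set Literature.Probability.LatticeModels Literature.Probability.Percolation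
open scoped Classical

namespace Consts

variable {V : Type*} [Fintype V]

/-! ### Degenerate slots -/

omit [Fintype V] in
/-- `{s ↮ X} = ∅` when `s ∈ X`. [folklore] -/
theorem avoidSet_eq_empty_of_mem {s : V} {X : Set V} (hs : s ∈ X) :
    {ω : BondConfig V | ∀ x ∈ X, ¬ (openGraph ω).Reachable s x} = ∅ :=
  Set.eq_empty_iff_forall_notMem.2 fun _ h => h s hs (SimpleGraph.Reachable.refl s)

omit [Fintype V] in
/-- A copy-0 degeneracy: if `s ∈ X₀` or `y ∈ {s} ∪ X₀` the polarised margin vanishes. [folklore] -/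
theorem polMargin_eq_zero_of_slot0 (μ : Measure (BondConfig V)) (s y z : V) (F : Set (Sym2 V) → ℝ) (X₀ X₁ X₂ : Set V)
    (h : s ∈ X₀ ∨ y ∈ insert s X₀) : polMargin μ s y z F X₀ X₁ X₂ = 0 := by
  have hAD : {ω : BondConfig V | ∀ x ∈ insert s X₀, ¬ (openGraph ω).Reachable y x} ∩
      {ω | ∀ x ∈ X₀, ¬ (openGraph ω).Reachable s x} = ∅ := by
    rcases h with hs | hy
    · rw [avoidSet_eq_empty_of_mem hs, Set.inter_empty]
    · rw [avoidSet_eq_empty_of_mem hy, Set.empty_inter]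
  unfold polMargin
  rw [hAD, Set.empty_inter, measureReal_empty]
  ring

omit [Fintype V] in
/-- A copy-1 degeneracy: if `s ∈ X₁` the polarised margin vanishes. [folklore] -/
theorem polMargin_eq_zero_of_slot1 (μ : Measure (BondConfig V)) (s y z : V) (F : Set (Sym2 V) → ℝ) (X₀ X₁ X₂ : Set V)
    (h : s ∈ X₁) : polMargin μ s y z F X₀ X₁ X₂ = 0 := by
  unfold polMargin
  rw [avoidSet_eq_empty_of_mem h, measureReal_empty, Measure.restrict_empty, integral_zero_measure]
  ring

omit [Fintype V] in
/-- A copy-2 degeneracy: if `s ∈ X₂` the polarised margin vanishes. [folklore] -/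
theorem polMargin_eq_zero_of_slot2 (μ : Measure (BondConfig V)) (s y z : V) (F : Set (Sym2 V) → ℝ) (X₀ X₁ X₂ : Set V)
    (h : s ∈ X₂) : polMargin μ s y z F X₀ X₁ X₂ = 0 := by
  unfold polMargin
  rw [avoidSet_eq_empty_of_mem h, Set.empty_inter, Set.empty_inter, measureReal_empty, Measure.restrict_empty,
    integral_zero_measure]
  ring

/-! ### The base case: no pair of positive weight at the avoided set -/

/-- **Base case.**  If every pair `s(x,u)` (`x ∈ X`, `u ≠ x`) has weight `0`, then `{s ↮ X}` is almost sure and MDL(X)′ is the tree's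
MDL(X) (`CovTau.markerDominanceAvoid`). [cite: VandenbergHaggstromKahn2005, §2.1 (pp. 9–13)] -/
theorem polMargin_nonneg_of_isolated (w : Sym2 V → unitInterval) (s y z : V) (X : Set V) (hsy : s ≠ y) (hs : s ∉ X)
    (hw : ∀ x ∈ X, ∀ u : V, u ≠ x → w s(x, u) = 0) (F : Set (Sym2 V) → ℝ) (hF : Monotone F) :
    0 ≤ polMargin (prodBernoulli w) s y z F X X X := by
  set μ := prodBernoulli w with hμ
  set D : Set (BondConfig V) := {ω | ∀ x ∈ X, ¬ (openGraph ω).Reachable s x} with hD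
  set A : Set (BondConfig V) := {ω | ∀ x ∈ insert s X, ¬ (openGraph ω).Reachable y x} with hA
  -- `D` is almost sure
  have hpair : ∀ x u : V, μ {ω : BondConfig V | x ∈ X ∧ u ≠ x ∧ s(x, u) ∈ ω} = 0 := by
    intro x u
    by_cases hxu : x ∈ X ∧ u ≠ x
    · have hset : {ω : BondConfig V | x ∈ X ∧ u ≠ x ∧ s(x, u) ∈ ω} = {ω | s(x, u) ∈ ω} := by
        ext ω; simp [hxu.1, hxu.2]
      have hreal : μ.real {ω : BondConfig V | s(x, u) ∈ ω} = 0 := by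
        rw [hμ, prodBernoulli_real_setOf_mem w s(x, u), hw x hxu.1 u hxu.2]; rfl
      rw [hset]
      exact (measureReal_eq_zero_iff (measure_ne_top μ _)).1 hreal
    · have hset : {ω : BondConfig V | x ∈ X ∧ u ≠ x ∧ s(x, u) ∈ ω} = ∅ :=
        Set.eq_empty_iff_forall_notMem.2 fun ω hω => hxu ⟨hω.1, hω.2.1⟩
      rw [hset, measure_empty]
  have hDc : μ Dᶜ = 0 := by
    have hsub : Dᶜ ⊆ ⋃ x : V, ⋃ u : V, {ω : BondConfig V | x ∈ X ∧ u ≠ x ∧ s(x, u) ∈ ω} := by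
      intro ω hω
      simp only [hD, Set.mem_compl_iff, Set.mem_setOf_eq, not_forall, not_not] at hω
      obtain ⟨x, hx, hr⟩ := hω
      have hxs : x ≠ s := fun h => hs (h ▸ hx)
      rw [SimpleGraph.reachable_iff_reflTransGen] at hr
      rcases (Relation.ReflTransGen.cases_tail_iff _ _ _).1 hr with h | ⟨c, -, hc⟩
      · exact absurd h hxs
      · rcases (openGraph_adj ω c x).1 hc with ⟨hmem, hne⟩
        refine Set.mem_iUnion.2 ⟨x, Set.mem_iUnion.2 ⟨c, hx, hne, ?_⟩⟩
        rw [Sym2.eq_swap]; exact hmem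
    exact measure_mono_null hsub (measure_iUnion_null fun x => measure_iUnion_null fun u => hpair x u)
  have hDae : D =ᵐ[μ] (Set.univ : Set (BondConfig V)) := ae_eq_univ.2 hDc
  have hAD : μ.real (A ∩ D) = μ.real A := by
    have h := measureReal_congr (inter_ae_eq_left_of_ae_eq_univ (s := A) hDae)
    exact h
  have hADW : μ.real (A ∩ D ∩ openConn y z) = μ.real (A ∩ openConn y z) := by
    rw [Set.inter_right_comm]
    exact measureReal_congr (inter_ae_eq_left_of_ae_eq_univ (s := A ∩ openConn y z) hDae)
  have key := CovTau.markerDominanceAvoid w s y z X hsy F hF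
  unfold polMargin
  rw [hAD, hADW]
  exact sub_nonneg.2 key

/-! ### CROSS at the marker: `u = y` -/

/-- **THEOREM — the CROSS members are nonnegative when the added vertex is the marker `y`.**  For `s, y ∉ X`, `s ≠ y`, monotone `F`, on a
weighted graph where MDL(X)′ holds for `(s,y,z,X)` at every monotone functional: with `X' = X ∪ {y}`, `M₁ ≥ 0` and `M₂ ≥ 0`.
(Identity `μ(D)μ(D')·M₁ = μ(D')²·margin(F) + μ(A∩D)·μ(D)²·cov_{D'}(F;Z) + cov_D(F;Y)·margin(1{s↔y})`, `D' = D ∩ {s ↮ y}`; every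
term is nonnegative by the hypothesis and vdBHK Thm 1.3.) [cite: VandenbergHaggstromKahn2005, Thm. 1.3 (p. 6), §2.1 (pp. 9–13)] -/
theorem crossRel_marker (w : Sym2 V → unitInterval) (s y z : V) (X : Set V) (hsy : s ≠ y) (hs : s ∉ X) (hy : y ∉ X)
    (F : Set (Sym2 V) → ℝ) (hF : Monotone F)
    (hIH : ∀ G : Set (Sym2 V) → ℝ, Monotone G → 0 ≤ polMargin (prodBernoulli w) s y z G X X X) :
    0 ≤ polMargin (prodBernoulli w) s y z F (insert y X) X X + polMargin (prodBernoulli w) s y z F X (insert y X) X +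
        polMargin (prodBernoulli w) s y z F X X (insert y X) ∧
      0 ≤ polMargin (prodBernoulli w) s y z F (insert y X) (insert y X) X +
          polMargin (prodBernoulli w) s y z F (insert y X) X (insert y X) +
        polMargin (prodBernoulli w) s y z F X (insert y X) (insert y X) := by
  have _hy := hy
  set μ := prodBernoulli w with hμ
  set D : Set (BondConfig V) := {ω | ∀ x ∈ X, ¬ (openGraph ω).Reachable s x} with hD
  set D' : Set (BondConfig V) := {ω | ∀ x ∈ insert y X, ¬ (openGraph ω).Reachable s x} with hD'
  set A : Set (BondConfig V) := {ω | ∀ x ∈ insert s X, ¬ (openGraph ω).Reachable y x} with hA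
  set A' : Set (BondConfig V) := {ω | ∀ x ∈ insert s (insert y X), ¬ (openGraph ω).Reachable y x} with hA'
  set Y : Set (BondConfig V) := openConn s y with hY
  set Z : Set (BondConfig V) := openConn s z with hZ
  -- set identities
  have hA'e : A' = ∅ := avoidSet_eq_empty_of_mem (Set.mem_insert_of_mem s (Set.mem_insert y X))
  have hD'eq : D' = D \ Y := by
    ext ω
    simp only [hD', hD, hY, Set.mem_setOf_eq, Set.forall_mem_insert, Set.mem_sdiff, openConn]
    tauto
  have hD'Y : D' ∩ Y = ∅ := by
    rw [hD'eq]; exact Set.sdiff_inter_self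
  have hD'Z : D' ∩ Z = (D ∩ Z) \ Y := by
    rw [hD'eq, Set.inter_sdiff_right_comm]
  -- the ten base quantities
  set t := μ.real (A ∩ D) with ht
  set tw := μ.real (A ∩ D ∩ openConn y z) with htw
  set d := μ.real D with hd
  set dy := μ.real (D ∩ Y) with hdy
  set dz := μ.real (D ∩ Z) with hdz
  set dzy := μ.real (D ∩ Z ∩ Y) with hdzy
  set f := ∫ ω in D, F (openEdgeCluster ω s) ∂μ with hf
  set fy := ∫ ω in D ∩ Y, F (openEdgeCluster ω s) ∂μ with hfy
  set fz := ∫ ω in D ∩ Z, F (openEdgeCluster ω s) ∂μ with hfz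
  set fzy := ∫ ω in D ∩ Z ∩ Y, F (openEdgeCluster ω s) ∂μ with hfzy
  -- the primed quantities
  set d' := μ.real D' with hd'
  set f' := ∫ ω in D', F (openEdgeCluster ω s) ∂μ with hf'
  set dz' := μ.real (D' ∩ Z) with hdz'
  set fz' := ∫ ω in D' ∩ Z, F (openEdgeCluster ω s) ∂μ with hfz'
  have hmeas : ∀ U : Set (BondConfig V), MeasurableSet U := fun _ => MeasurableSet.of_discrete
  have e_d' : d' = d - dy := by
    have h := measureReal_inter_add_sdiff (μ := μ) (s := D) (hmeas Y)
    rw [hd', hD'eq]; linarith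
  have e_f' : f' = f - fy := by
    have h := integral_inter_add_sdiff (μ := μ) (s := D) (hmeas Y) ((Integrable.of_finite (f := fun ω => F (openEdgeCluster ω s))).integrableOn)
    rw [hf', hD'eq]; linarith
  have e_dz' : dz' = dz - dzy := by
    have h := measureReal_inter_add_sdiff (μ := μ) (s := D ∩ Z) (hmeas Y)
    rw [hdz', hD'Z]; linarith
  have e_fz' : fz' = fz - fzy := by
    have h := integral_inter_add_sdiff (μ := μ) (s := D ∩ Z) (hmeas Y) ((Integrable.of_finite (f := fun ω => F (openEdgeCluster ω s))).integrableOn)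
    rw [hfz', hD'Z]; linarith
  have e_t' : μ.real (A' ∩ D') = 0 := by rw [hA'e, Set.empty_inter, measureReal_empty]
  have e_tw' : μ.real (A' ∩ D' ∩ openConn y z) = 0 := by rw [hA'e, Set.empty_inter, Set.empty_inter, measureReal_empty]
  have e_dy' : μ.real (D' ∩ Y) = 0 := by rw [hD'Y, measureReal_empty]
  have e_fy' : ∫ ω in D' ∩ Y, F (openEdgeCluster ω s) ∂μ = 0 := by rw [hD'Y, Measure.restrict_empty, integral_zero_measure]
  -- the four nonnegative inputs
  have hM : 0 ≤ t * (d * fz - f * dz) - tw * (d * fy - f * dy) := by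
    have h := hIH F hF
    unfold polMargin at h
    exact h
  have hcY : 0 ≤ d * fy - f * dy := by
    have h := covD_conn_nonneg w s X hs F hF y
    unfold CSH.covD at h
    exact h
  have hcov' : 0 ≤ d' * fz' - f' * dz' := by
    have hs' : s ∉ insert y X := fun h => (Set.mem_insert_iff.1 h).elim hsy hs
    have h := covD_conn_nonneg w s (insert y X) hs' F hF z
    unfold CSH.covD at h
    exact h
  have hSig : 0 ≤ t * (d * dzy - dy * dz) - tw * (d * dy - dy * dy) := by
    have h := hIH (connIndicatorFn s y) (monotone_connIndicatorFn s y)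
    unfold polMargin at h
    simp only [connIndicatorFn_openEdgeCluster] at h
    rw [KNPreFKG.setIntegral_indicator_one_eq μ D, KNPreFKG.setIntegral_indicator_one_eq μ (D ∩ openConn s z),
      KNPreFKG.setIntegral_indicator_one_eq μ (D ∩ openConn s y), Set.inter_assoc D (openConn s y), Set.inter_self] at h
    exact h
  -- nonnegativity of masses
  have hd'0 : 0 ≤ d' := measureReal_nonneg
  have ht0 : 0 ≤ t := measureReal_nonneg
  have hd'le : d' ≤ d := by rw [e_d']; linarith [(measureReal_nonneg : 0 ≤ dy)]
  constructor
  · -- M₁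
    unfold polMargin
    rw [e_t', e_tw', e_dy', e_fy']
    simp only [← hD, ← hD', ← hA, ← hY, ← hZ, ← ht, ← htw, ← hd, ← hdy, ← hdz, ← hf, ← hfy, ← hfz, ← hd', ← hf', ← hdz', ← hfz']
    -- goal: 0 ≤ [0·… − 0·…] + [t(d' fz − f' dz) − tw(d' fy − f' dy)] + [t(d fz' − f dz') − tw(d·0 − f·0)]
    by_cases hdeg : d' = 0
    · -- `D'` is null: all primed quantities vanish
      have hD'null : μ D' = 0 := (measureReal_eq_zero_iff (measure_ne_top μ _)).1 (by rw [← hd']; exact hdeg)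
      have hf'0 : f' = 0 := by rw [hf']; exact setIntegral_measure_zero (fun ω => F (openEdgeCluster ω s)) hD'null
      have hdz'0 : dz' = 0 := by
        rw [hdz']; exact (measureReal_eq_zero_iff (measure_ne_top μ _)).2 (measure_mono_null Set.inter_subset_left hD'null)
      have hfz'0 : fz' = 0 := by
        rw [hfz']; exact setIntegral_measure_zero (fun ω => F (openEdgeCluster ω s)) (measure_mono_null Set.inter_subset_left hD'null)
      rw [hdeg, hf'0, hdz'0, hfz'0]
      simp
    · have hd'pos : 0 < d' := lt_of_le_of_ne hd'0 (Ne.symm hdeg)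
      have hdpos : 0 < d := lt_of_lt_of_le hd'pos hd'le
      have key : d * d' * (0 * (d * fz - f * dz) - 0 * (d * fy - f * dy) +
            (t * (d' * fz - f' * dz) - tw * (d' * fy - f' * dy)) +
            (t * (d * fz' - f * dz') - tw * (d * 0 - f * 0))) =
          d' ^ 2 * (t * (d * fz - f * dz) - tw * (d * fy - f * dy)) + t * d ^ 2 * (d' * fz' - f' * dz') +
            (d * fy - f * dy) * (t * (d * dzy - dy * dz) - tw * (d * dy - dy * dy)) := by
        rw [e_d', e_f', e_dz', e_fz']; ring
      have hprod : 0 ≤ d * d' * (0 * (d * fz - f * dz) - 0 * (d * fy - f * dy) +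
            (t * (d' * fz - f' * dz) - tw * (d' * fy - f' * dy)) +
            (t * (d * fz' - f * dz') - tw * (d * 0 - f * 0))) := by
        rw [key]
        have h1 : 0 ≤ d' ^ 2 * (t * (d * fz - f * dz) - tw * (d * fy - f * dy)) := mul_nonneg (sq_nonneg _) hM
        have h2 : 0 ≤ t * d ^ 2 * (d' * fz' - f' * dz') := mul_nonneg (mul_nonneg ht0 (sq_nonneg _)) hcov'
        have h3 : 0 ≤ (d * fy - f * dy) * (t * (d * dzy - dy * dz) - tw * (d * dy - dy * dy)) := mul_nonneg hcY hSig
        linarith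
      exact (mul_nonneg_iff_of_pos_left (mul_pos hdpos hd'pos)).1 hprod
  · -- M₂ = t · cov'
    unfold polMargin
    rw [e_t', e_tw', e_dy', e_fy']
    simp only [← hD, ← hD', ← hA, ← hY, ← hZ, ← ht, ← htw, ← hd, ← hdy, ← hdz, ← hf, ← hfy, ← hfz, ← hd', ← hf', ← hdz', ← hfz']
    have h2 : 0 ≤ t * (d' * fz' - f' * dz') := mul_nonneg ht0 hcov'
    nlinarith [h2]

/-! ### CROSS and the induction -/

/-- **CONJECTURE CROSS (relative form; OPEN, this programme).**  On every finite weighted graph on which MDL(X)′ (`Consts.MDLXJoint`'s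
inequality) holds for all placements and all monotone functionals, for all `s ≠ y`, `X ∌ s, y`, `u ∉ X ∪ {s,y}` and monotone `F`, the two
CROSS members of the polarised margin (`Consts.polMargin`) for the nested avoided sets `X ⊂ X ∪ {u}` are nonnegative:
`P(X',X,X) + P(X,X',X) + P(X,X,X') ≥ 0` and `P(X',X',X) + P(X',X,X') + P(X,X',X') ≥ 0` (`X' = X ∪ {u}`).  They are the two middle Bernstein
coefficients, in the weight of a pair `x–u` (`x ∈ X`), of the MDL(X)′ margin of the graph with that pair added (`Consts.polMargin_xEdge_expand`);
`Consts.mdlxJoint_of_crossRel` turns the conjecture into a proof of `Consts.MDLXJoint` by induction.  Implied by `Consts.MDLXJointBernstein`.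
EVIDENCE: exact census (all up-sets, min-cut), 0 violations on ≈ 1 200 random weighted graphs `n ≤ 7` (seat prim-consts-2 gen 18).
builds on p205010 (kernel theorem, internal audit signed; external expert review pending).
[cite: VandenbergHaggstromKahn2005, Thm. 1.1 (pp. 3–5), §2.1 (pp. 9–13)] [status: open] -/
@[conjecture] def CrossRel : Prop :=
  ∀ (n : ℕ) (w : Sym2 (Fin n) → unitInterval) (s y z u : Fin n) (X : Set (Fin n)),
    s ≠ y → s ∉ X → y ∉ X → u ∉ X → u ≠ s → u ≠ y →
    (∀ (s' y' z' : Fin n) (X' : Set (Fin n)), s' ≠ y' → ∀ G : Set (Sym2 (Fin n)) → ℝ, Monotone G →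
        0 ≤ polMargin (prodBernoulli w) s' y' z' G X' X' X') →
    ∀ F : Set (Sym2 (Fin n)) → ℝ, Monotone F →
      0 ≤ polMargin (prodBernoulli w) s y z F (insert u X) X X + polMargin (prodBernoulli w) s y z F X (insert u X) X +
            polMargin (prodBernoulli w) s y z F X X (insert u X) ∧
        0 ≤ polMargin (prodBernoulli w) s y z F (insert u X) (insert u X) X +
            polMargin (prodBernoulli w) s y z F (insert u X) X (insert u X) +
          polMargin (prodBernoulli w) s y z F X (insert u X) (insert u X)

/-- The four Bernstein members for a generic added vertex `u`, from CROSS and MDL(X)′ on the same weights (case analysis on `u`: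
inside `X`, the owner, the marker, or generic). [cite: VandenbergHaggstromKahn2005, Thm. 1.1 (pp. 3–5)] -/
theorem members_nonneg_of_crossRel (hC : CrossRel) {n : ℕ} (w₀ : Sym2 (Fin n) → unitInterval) (s y z u : Fin n)
    (X : Set (Fin n)) (hsy : s ≠ y) (hs : s ∉ X) (hy : y ∉ X)
    (IH : ∀ (s' y' z' : Fin n) (X' : Set (Fin n)), s' ≠ y' → ∀ G : Set (Sym2 (Fin n)) → ℝ, Monotone G →
        0 ≤ polMargin (prodBernoulli w₀) s' y' z' G X' X' X')
    (F : Set (Sym2 (Fin n)) → ℝ) (hF : Monotone F) :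
    0 ≤ polMargin (prodBernoulli w₀) s y z F X X X ∧
      0 ≤ polMargin (prodBernoulli w₀) s y z F (insert u X) X X + polMargin (prodBernoulli w₀) s y z F X (insert u X) X +
            polMargin (prodBernoulli w₀) s y z F X X (insert u X) ∧
        0 ≤ polMargin (prodBernoulli w₀) s y z F (insert u X) (insert u X) X +
              polMargin (prodBernoulli w₀) s y z F (insert u X) X (insert u X) +
            polMargin (prodBernoulli w₀) s y z F X (insert u X) (insert u X) ∧
          0 ≤ polMargin (prodBernoulli w₀) s y z F (insert u X) (insert u X) (insert u X) := by
  have h0 : 0 ≤ polMargin (prodBernoulli w₀) s y z F X X X := IH s y z X hsy F hF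
  refine ⟨h0, ?_⟩
  by_cases huX : u ∈ X
  · rw [Set.insert_eq_of_mem huX]
    exact ⟨by linarith, by linarith, h0⟩
  by_cases hus : u = s
  · subst hus
    rw [polMargin_eq_zero_of_slot0 _ u y z F (insert u X) X X (Or.inl (Set.mem_insert u X)),
      polMargin_eq_zero_of_slot1 _ u y z F X (insert u X) X (Set.mem_insert u X),
      polMargin_eq_zero_of_slot2 _ u y z F X X (insert u X) (Set.mem_insert u X),
      polMargin_eq_zero_of_slot0 _ u y z F (insert u X) (insert u X) X (Or.inl (Set.mem_insert u X)),
      polMargin_eq_zero_of_slot0 _ u y z F (insert u X) X (insert u X) (Or.inl (Set.mem_insert u X)),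
      polMargin_eq_zero_of_slot1 _ u y z F X (insert u X) (insert u X) (Set.mem_insert u X),
      polMargin_eq_zero_of_slot0 _ u y z F (insert u X) (insert u X) (insert u X) (Or.inl (Set.mem_insert u X))]
    simp
  by_cases huy : u = y
  · subst huy
    have hm := crossRel_marker w₀ s u z X hsy hs hy F hF (IH s u z X hsy)
    refine ⟨hm.1, hm.2, ?_⟩
    exact (polMargin_eq_zero_of_slot0 _ s u z F (insert u X) (insert u X) (insert u X)
      (Or.inr (Set.mem_insert_of_mem s (Set.mem_insert u X)))).symm.le
  · have hc := hC n w₀ s y z u X hsy hs hy huX hus huy IH F hF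
    exact ⟨hc.1, hc.2, IH s y z (insert u X) hsy F hF⟩

/-- The induction behind `Consts.mdlxJoint_of_crossRel`: MDL(X)′ for every weight vector with `k` pairs of nonzero weight.
[cite: VandenbergHaggstromKahn2005, Thm. 1.1 (pp. 3–5)] -/
theorem polMargin_nonneg_of_crossRel (hC : CrossRel) (n : ℕ) :
    ∀ (k : ℕ) (w : Sym2 (Fin n) → unitInterval), (Finset.univ.filter fun d => w d ≠ 0).card = k →
      ∀ (s y z : Fin n) (X : Set (Fin n)), s ≠ y → ∀ F : Set (Sym2 (Fin n)) → ℝ, Monotone F →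
        0 ≤ polMargin (prodBernoulli w) s y z F X X X := by
  intro k
  induction k using Nat.strong_induction_on with
  | _ k ih =>
    intro w hk s y z X hsy F hF
    by_cases hs : s ∈ X
    · exact (polMargin_eq_zero_of_slot0 _ s y z F X X X (Or.inl hs)).symm.le
    by_cases hy : y ∈ X
    · exact (polMargin_eq_zero_of_slot0 _ s y z F X X X (Or.inr (Set.mem_insert_of_mem s hy))).symm.le
    by_cases hex : ∃ x ∈ X, ∃ u : Fin n, u ≠ x ∧ w s(x, u) ≠ 0
    · obtain ⟨x, hx, u, hux, hwe⟩ := hex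
      -- the pair-deleted weights have fewer pairs of nonzero weight
      have hlt : (Finset.univ.filter fun d : Sym2 (Fin n) =>
          (if d = s(x, u) then (0 : unitInterval) else w d) ≠ 0).card < k := by
        have hsub : (Finset.univ.filter fun d : Sym2 (Fin n) => (if d = s(x, u) then (0 : unitInterval) else w d) ≠ 0) =
            (Finset.univ.filter fun d => w d ≠ 0).erase s(x, u) := by
          ext d
          simp only [Finset.mem_filter, Finset.mem_univ, true_and, Finset.mem_erase]
          by_cases hde : d = s(x, u)
          · rw [if_pos hde]
            constructor
            · intro h; exact absurd rfl h
            · rintro ⟨h, -⟩; exact absurd hde h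
          · rw [if_neg hde]
            constructor
            · intro h; exact ⟨hde, h⟩
            · rintro ⟨-, h⟩; exact h
        rw [hsub, ← hk]
        exact Finset.card_erase_lt_of_mem (Finset.mem_filter.2 ⟨Finset.mem_univ _, hwe⟩)
      have IH : ∀ (s' y' z' : Fin n) (X' : Set (Fin n)), s' ≠ y' → ∀ G : Set (Sym2 (Fin n)) → ℝ, Monotone G →
          0 ≤ polMargin (prodBernoulli fun d => if d = s(x, u) then (0 : unitInterval) else w d) s' y' z' G X' X' X' :=
        fun s' y' z' X' h' G hG => ih _ hlt (fun d => if d = s(x, u) then (0 : unitInterval) else w d) rfl s' y' z' X' h' G hG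
      obtain ⟨h0, h1, h2, h3⟩ :=
        members_nonneg_of_crossRel hC (fun d => if d = s(x, u) then (0 : unitInterval) else w d) s y z u X hsy hs hy IH F hF
      refine polMargin_nonneg_of_members w s y z x u X hx F ?_ ?_ ?_ ?_
      · convert h0
      · convert h1
      · convert h2
      · convert h3
    · -- base case: no pair of nonzero weight at `X`
      push Not at hex
      exact polMargin_nonneg_of_isolated w s y z X hsy hs (fun x hx u hu => hex x hx u hu) F hF

/-- **THEOREM: CROSS ⟹ MDL(X)′** (`Consts.CrossRel → Consts.MDLXJoint`). [cite: VandenbergHaggstromKahn2005, Thm. 1.1 (pp. 3–5), §2.1 (pp. 9–13)] -/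
theorem mdlxJoint_of_crossRel (hC : CrossRel) : MDLXJoint :=
  mdlxJoint_iff_polMargin.2 fun n w s y z X hsy F hF =>
    polMargin_nonneg_of_crossRel hC n _ w rfl s y z X hsy F hF

end Consts

end Summit.CriticalPhenomena.PercolationContinuityZ3.Theorems

end
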